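import Mathlib
import Literature.Computability.AlgebraicComplexity.RelativeRank
import Summits.ValiantsHypothesis.ValiantsHypothesis.Theorems.BarrierLeverDefinableEquationsRankTemplate

/-!
# Route BarrierLever — BLOCK PLACEMENTS: set-multilinear ("relative rank") coefficient matrices
# are coordinate rank methods, hence `q = 0` natural proofs; the LST measure `pdRank` of the tree
# is the rank of a matrix of COEFFICIENTS of `f` (model axis of crux 8745 / item 8749; val-np-p5 g8)

Part 1 of the recommended constant product-depth slice (memo `LANDSCAPE-8749-g8.md`, R1), generic
in the block structure.  Data: finitely many blocks `X i` (`i : ι`) of variables, an EMBEDDING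
`e : (Σ i, X i) ↪ Fin n` of the block variables among `x_1, …, x_n`, disjoint block sets `A, B`
with `#A + #B ≤ n`.  For `f ∈ ℂ[x_1..x_n]` the BLOCK COEFFICIENT MATRIX has rows the assignments
on `A` (one variable per block), columns the assignments on `B`, and entry the coefficient of `f`
at the embedded set-multilinear monomial `e_*(x^{rr} x^{cc})` (degree `#A + #B ≤ n`, so a
coordinate of `degLEMonomials n`).

* §1 `placement_injective`: distinct (row, column) pairs give distinct coordinates
  (`assignMonomial_add_injective` of the tree + injectivity of `mapDomain e`).
* §2 `rank_block_le` (`Matrix.rank_submatrix_le`) and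
  **`not_isSuccinctHittingSet_of_blockRank_lt`**: if on a class `𝒞` the block coefficient matrix
  has rank `< r ≤ min(#rows, #cols)` then `𝒞` is not a succinct hitting set for
  `Distinguishers ℂ n a` (`8(r+1)^7 ≤ C(2n,n)^a`) — by the landed template
  `RankTemplate.not_isSuccinctHittingSet_of_rank_lt` on any `r` rows and `r` columns.
* §3 the LINK to the tree's LST vocabulary (`RelativeRank.lean`): the substitution "rename the
  variables in the range of `e` to block variables, kill the others" is Mathlib's
  `MvPolynomial.killCompl`, and `coeffMat ℂ A B (killCompl e f)` IS the block coefficient matrix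
  (`coeffMat_killCompl`, from `MvPolynomial.coeff_killCompl`), `pdRank ℂ A B (killCompl e f)` is
  its rank (`pdRank_killCompl_eq_rank`), `killCompl e` is a BLOCK-PRESERVING substitution
  (`isBlockPreserving_killCompl`, `killCompl_eq_aeval`) — so the tree's engine
  `LSTWord.relRank_aeval_eval_le` (LST 2025 Claim 16, `LowDepthRankBound.lean`) applies to it —
  and **`not_isSuccinctHittingSet_of_pdRank_lt`**: a bound `pdRank ℂ A B (killCompl e f) < r` on a
  class yields the natural proof.

WHAT REMAINS for "natural proofs against product-depth-`Δ` circuits of size `n^b`, every `b, Δ`":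
instantiate with LST's word blocks (`BlockVar k pos i`, `pos = greedyWord d k`,
`Σ_i 2^{letterSize} ≤ n`) and prove the ARITHMETIC `Λ(n^b, n, d, Δ) · Φ(k, Δ, d) < 2^{-|w_{[d]}|/2}`
for `d = d(b, Δ)` constant and `k ≈ log₂ n` (the content of `LSTWord.final_arith`), which turns
the engine's `relRank` bound into `pdRank < min(#rows, #cols)`.  No definitions, no named facts;
nothing here bears on the crux's verdict (b = 2 OPEN) or on `VP ≠ VNP`.
-/

-- `Summit.ValiantsHypothesis.ValiantsHypothesis.…` repeats a component by the D-0017 layout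
-- (single-conjunct summit), which the `dupNamespace` linter flags; the name is mandated.
set_option linter.dupNamespace false

noncomputable section

namespace Summit.ValiantsHypothesis.ValiantsHypothesis.Theorems.BarrierLeverDefinableEquations

open MvPolynomial
open Literature.Computability.AlgebraicComplexity Literature.Barriers.ValiantsHypothesis
open scoped BigOperators

namespace BlockPlacement

variable {n : ℕ} {ι : Type} {X : ι → Type}

/-! ## §1 Block-structured monomials embedded into the `n` variables -/

/-- The degree of an assignment monomial is the number of blocks. [folklore] -/
theorem degree_assignMonomial (A : Finset ι) (r : Assignment X A) :
    (assignMonomial A r).degree = A.card := by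
  unfold assignMonomial
  rw [map_sum]
  simp only [Finsupp.degree_single, Finset.sum_const, Finset.card_attach, smul_eq_mul, mul_one]

/-- The embedded monomial of a pair of assignments on disjoint... (any) block sets `A, B` with
`#A + #B ≤ n` has degree `≤ n`. [folklore] -/
theorem degree_mapDomain_add_le (e : (Σ i, X i) ↪ Fin n) {A B : Finset ι} (hAB : A.card + B.card ≤ n)
    (r : Assignment X A) (c : Assignment X B) :
    (Finsupp.mapDomain e (assignMonomial A r + assignMonomial B c)).degree ≤ n := by
  rw [Finsupp.degree_mapDomain, map_add, degree_assignMonomial, degree_assignMonomial]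
  exact hAB

/-- **The placement.**  For an embedding `e` of the block variables into `Fin n`, block sets
`A, B` with `#A + #B ≤ n`, and index maps `ρ, κ` into the assignments on `A` resp. `B`, the
coefficient coordinate of the embedded set-multilinear monomial `x^{ρ i} · x^{κ j}`. (Written as a
term, no new definition: `⟨mapDomain e (assignMonomial A (ρ i) + assignMonomial B (κ j)), _⟩`.)
Injective as soon as `A, B` are disjoint and `ρ, κ` are injective. [folklore] -/
theorem placement_injective [DecidableEq ι] (e : (Σ i, X i) ↪ Fin n) {A B : Finset ι}
    (hAB : Disjoint A B)
    (hn : A.card + B.card ≤ n) {r : ℕ} (ρ : Fin r ↪ Assignment X A) (κ : Fin r ↪ Assignment X B) :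
    Function.Injective (Function.uncurry fun i j =>
      (⟨Finsupp.mapDomain e (assignMonomial A (ρ i) + assignMonomial B (κ j)),
        degree_mapDomain_add_le e hn (ρ i) (κ j)⟩ : ↥(degLEMonomials n))) := by
  rintro ⟨i, j⟩ ⟨i', j'⟩ h
  simp only [Function.uncurry_apply_pair, Subtype.mk.injEq] at h
  have h' := Finsupp.mapDomain_injective e.injective h
  obtain ⟨h1, h2⟩ := assignMonomial_add_injective hAB h'
  simp only [Prod.mk.injEq]
  exact ⟨ρ.injective h1, κ.injective h2⟩

/-! ## §2 The block coefficient matrix of `f` and its square blocks -/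

/-- A square block of the block coefficient matrix has rank at most that of the whole matrix.
[folklore] -/
theorem rank_block_le [DecidableEq ι] [∀ i, Fintype (X i)] (e : (Σ i, X i) ↪ Fin n)
    {A B : Finset ι} (f : MvPolynomial (Fin n) ℂ)
    {r : ℕ} (ρ : Fin r ↪ Assignment X A) (κ : Fin r ↪ Assignment X B) :
    (Matrix.of fun i j =>
        coeff (Finsupp.mapDomain e (assignMonomial A (ρ i) + assignMonomial B (κ j))) f).rank ≤
      (Matrix.of fun (rr : Assignment X A) (cc : Assignment X B) =>
        coeff (Finsupp.mapDomain e (assignMonomial A rr + assignMonomial B cc)) f).rank := by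
  have h := Matrix.rank_submatrix_le
    (Matrix.of fun (rr : Assignment X A) (cc : Assignment X B) =>
      coeff (Finsupp.mapDomain e (assignMonomial A rr + assignMonomial B cc)) f) ρ κ
  exact le_of_eq_of_le (by congr 1) h

/-- **Block coefficient matrices of deficient rank give natural proofs (`q = 0`).**  Let `e`
embed the block variables into `Fin n`, `A, B` disjoint block sets with `#A + #B ≤ n`, and
`r ≤` both numbers of assignments.  If for every `f` in a class `𝒞` the block coefficient matrix
`(coeff_{x^{rr} x^{cc}} f)_{rr, cc}` (rows: assignments on `A`, columns: assignments on `B`,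
monomials embedded by `e`) has rank `< r`, then — for `8(r+1)^7 ≤ C(2n,n)^a` — 𝒞 is not a
succinct hitting set for `Distinguishers ℂ n a`: the `r × r` coordinate determinant on any
`r` rows and `r` columns is an FSV natural proof (`RankTemplate.isNaturalProof_det`).  This is
the shape of every "relative rank" measure (Nisan; Raz; Limaye–Srinivasan–Tavenas `coeffMat`).
[cite: ForbesShpilkaVolk2018, Def. 1 and Thm. 4] -/
theorem not_isSuccinctHittingSet_of_blockRank_lt [DecidableEq ι] [∀ i, Fintype (X i)]
    (e : (Σ i, X i) ↪ Fin n) {A B : Finset ι} (hAB : Disjoint A B) (hn : A.card + B.card ≤ n) {r : ℕ}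
    (hrA : r ≤ Fintype.card (Assignment X A)) (hrB : r ≤ Fintype.card (Assignment X B))
    {𝒞 : Set (MvPolynomial (Fin n) ℂ)}
    (hrank : ∀ f ∈ 𝒞, (Matrix.of fun (rr : Assignment X A) (cc : Assignment X B) =>
      coeff (Finsupp.mapDomain e (assignMonomial A rr + assignMonomial B cc)) f).rank < r)
    {a : ℕ} (hr : 8 * (r + 1) ^ 7 ≤ Nat.choose (2 * n) n ^ a) :
    ¬ IsSuccinctHittingSet (degLEMonomials n) 𝒞 (Distinguishers ℂ n a) := by
  classical
  -- choose `r` rows and `r` columns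
  obtain ⟨ρ⟩ : Nonempty (Fin r ↪ Assignment X A) :=
    Function.Embedding.nonempty_of_card_le (by rwa [Fintype.card_fin])
  obtain ⟨κ⟩ : Nonempty (Fin r ↪ Assignment X B) :=
    Function.Embedding.nonempty_of_card_le (by rwa [Fintype.card_fin])
  refine RankTemplate.not_isSuccinctHittingSet_of_rank_lt
    (fun i j => (⟨Finsupp.mapDomain e (assignMonomial A (ρ i) + assignMonomial B (κ j)),
      degree_mapDomain_add_le e hn (ρ i) (κ j)⟩ : ↥(degLEMonomials n)))
    (placement_injective e hAB hn ρ κ) (fun f hf => ?_) hr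
  exact lt_of_le_of_lt (rank_block_le e f ρ κ) (hrank f hf)

/-! ## §3 The link to the tree's `coeffMat` / `pdRank` (LST 2025 §2.1): renaming-and-killing
## the variables outside the blocks is Mathlib's `killCompl` -/

/-- For the embedding `e` of the block variables into `Fin n`, the block coefficient matrix of
`f` IS the tree's `coeffMat A B` of `killCompl e f` — `f` with the variables in the range of `e`
renamed to block variables and all other variables set to `0` (`MvPolynomial.coeff_killCompl`).
[cite: LimayeSrinivasanTavenas2025, §2.1] -/
theorem coeffMat_killCompl (e : (Σ i, X i) ↪ Fin n) (A B : Finset ι) (f : MvPolynomial (Fin n) ℂ)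
    (rr : Assignment X A) (cc : Assignment X B) :
    coeffMat ℂ A B (killCompl e.injective f) rr cc =
      coeff (Finsupp.mapDomain e (assignMonomial A rr + assignMonomial B cc)) f := by
  rw [coeffMat_apply, coeff_killCompl]

/-- Hence the tree's `pdRank A B (killCompl e f)` is the rank of the block coefficient matrix of
`f`. [cite: LimayeSrinivasanTavenas2025, §2.1] -/
theorem pdRank_killCompl_eq_rank [DecidableEq ι] [∀ i, Fintype (X i)] (e : (Σ i, X i) ↪ Fin n)
    (A B : Finset ι) (f : MvPolynomial (Fin n) ℂ) :
    pdRank ℂ A B (killCompl e.injective f) =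
      (Matrix.of fun (rr : Assignment X A) (cc : Assignment X B) =>
        coeff (Finsupp.mapDomain e (assignMonomial A rr + assignMonomial B cc)) f).rank := by
  rw [pdRank, Matrix.rank_eq_finrank_span_row]
  have hrow : (Matrix.of fun (rr : Assignment X A) (cc : Assignment X B) =>
      coeff (Finsupp.mapDomain e (assignMonomial A rr + assignMonomial B cc)) f).row =
      coeffMat ℂ A B (killCompl e.injective f) := by
    funext rr cc
    rw [Matrix.row_apply, Matrix.of_apply, coeffMat_killCompl]
  rw [hrow]

open scoped Classical in
/-- `killCompl e` is the substitution `x_v ↦ y_{e⁻¹ v}` on the range of `e` and `x_v ↦ 0` off it;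
it is BLOCK-PRESERVING (LST 2025 Lemma 8) for the block map `blk₀ v = (e⁻¹ v).1` (any value off
the range), so the tree's engine `LSTWord.relRank_aeval_eval_le` applies to it.
[cite: LimayeSrinivasanTavenas2025, Lemma 8] -/
theorem isBlockPreserving_killCompl (e : (Σ i, X i) ↪ Fin n) (i₀ : ι) :
    IsBlockPreserving
      (fun v : Fin n => if h : v ∈ Set.range e then
        ((Equiv.ofInjective e e.injective).symm ⟨v, h⟩).1 else i₀)
      (Sigma.fst : (Σ i, X i) → ι)
      (fun v : Fin n => if h : v ∈ Set.range e then
        (MvPolynomial.X ((Equiv.ofInjective e e.injective).symm ⟨v, h⟩) :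
          MvPolynomial (Σ i, X i) ℂ) else 0) := by
  intro v
  by_cases h : v ∈ Set.range e
  · simp only [dif_pos h]
    exact isWeightedHomogeneous_X ℂ _ _
  · simp only [dif_neg h]
    exact isWeightedHomogeneous_zero ℂ _ _

open scoped Classical in
/-- The substitution of `isBlockPreserving_killCompl` computes `killCompl e` (definitional).
[folklore] -/
theorem killCompl_eq_aeval (e : (Σ i, X i) ↪ Fin n) (f : MvPolynomial (Fin n) ℂ) :
    killCompl e.injective f =
      aeval (fun v : Fin n => if h : v ∈ Set.range e then
        (MvPolynomial.X ((Equiv.ofInjective e e.injective).symm ⟨v, h⟩) :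
          MvPolynomial (Σ i, X i) ℂ) else 0) f :=
  rfl

/-- **What remains for a rank-method slice in LST's format.**  If for every `f` in a class `𝒞`
of degree-`≤ n` polynomials the tree's measure satisfies
`pdRank ℂ A B (killCompl e f) < r ≤ min(#rows, #cols)` (`A, B` disjoint, `#A + #B ≤ n`), then
`𝒞` is not a succinct hitting set for `Distinguishers ℂ n a` whenever `8(r+1)^7 ≤ C(2n,n)^a`.
For the constant product-depth slice: `pdRank < min` is `relRank < 2^{-|w_{[d]}|/2}`, which the
engine `LSTWord.relRank_aeval_eval_le` gives once `Λ(n^b, n, d, Δ) · Φ(k, Δ, d) < 2^{-|w|/2}`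
(the arithmetic of `LSTWord.final_arith`). [cite: ForbesShpilkaVolk2018, Thm. 4] -/
theorem not_isSuccinctHittingSet_of_pdRank_lt [DecidableEq ι] [∀ i, Fintype (X i)]
    (e : (Σ i, X i) ↪ Fin n) {A B : Finset ι} (hAB : Disjoint A B) (hn : A.card + B.card ≤ n)
    {r : ℕ} (hrA : r ≤ Fintype.card (Assignment X A)) (hrB : r ≤ Fintype.card (Assignment X B))
    {𝒞 : Set (MvPolynomial (Fin n) ℂ)}
    (hrank : ∀ f ∈ 𝒞, pdRank ℂ A B (killCompl e.injective f) < r)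
    {a : ℕ} (hr : 8 * (r + 1) ^ 7 ≤ Nat.choose (2 * n) n ^ a) :
    ¬ IsSuccinctHittingSet (degLEMonomials n) 𝒞 (Distinguishers ℂ n a) :=
  not_isSuccinctHittingSet_of_blockRank_lt e hAB hn hrA hrB
    (fun f hf => by rw [← pdRank_killCompl_eq_rank]; exact hrank f hf) hr

end BlockPlacement

end Summit.ValiantsHypothesis.ValiantsHypothesis.Theorems.BarrierLeverDefinableEquations
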